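import Literature.Probability.RandomPlanarGeometry.SAWSubBallisticEightDirections
import HarnessLib

/-!
# Sixteen lattice directions for Duminil-Copin–Hammond sub-ballisticity on `ℤ²`: the `(2,1)` tilt and the covering

Topic `Literature/Probability/RandomPlanarGeometry` (preliminaries for `SAWSubBallisticSixteenDirections.lean`,
continuing `SAWSubBallisticEightDirPrelim.lean`).

* `tilt21 a b` — letter weights `a⁴, a³b, b⁴, ab³` realising the tilt `(a/b)^{2x+y}`; `wprod_tilt21_eq`;
* `card_sawWords_d21_ge_le` — the Chernoff bound `#{w ∈ sawWords n : 2x(w)+y(w) ≥ m} ≤ 2⁴¹(N/(Da²b²))ⁿ(b/a)^m`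
  from `FiniteMemory.checkT K a⁴ (a³b) b⁴ (ab³) N D`; `card_maxEvent21_le_of_checkT` — its max-over-time form;
* `exists_dir16_ge_of_euclidNorm_ge` — planar covering: a vector of norm `≥ R` has `x`-type projection
  `≥ 0.9732R` onto an axis direction, or `x ± y ≥ 1.3959R`, or `2x ± y`, `x ± 2y ≥ 2.176R` (up to signs); the
  polygon `|x|,|y| < .9732R, |x|+|y| < 1.3959R, 2|x|+|y|, |x|+2|y| < 2.176R` lies inside the disc of radius `R`
  (vertex values `0.99983R²`, `0.9878R²`).

## References

* H. Duminil-Copin, A. Hammond, *Self-avoiding walk is sub-ballistic*, Commun. Math. Phys. 324 (2013) 401–423,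
  Theorem 1.1, §2.4 [DuminilCopinHammond2013].
-/

open Finset Literature.Probability.LatticeModels
open scoped BigOperators

namespace Literature.Probability.RandomPlanarGeometry.SAW

open FiniteMemory

/-! ### The `(2,1)`-tilt: `Π W(w_i) = (ab)^{2|w|} (a/b)^{2x(w)+y(w)}` -/

/-- The letter weights of the `(2,1)`-tilt with base `a/b`: `W(+e₀) = a⁴`, `W(+e₁) = a³b`, `W(−e₀) = b⁴`,
`W(−e₁) = ab³`. [cite: DuminilCopinHammond2013, §2.4] -/
def tilt21 (a b : ℕ) : Step → ℕ := wts (a ^ 4) (a ^ 3 * b) (b ^ 4) (a * b ^ 3)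

/-- **`Π_i tilt21(w_i) = ((ab)²)^{|w|} · (a/b)^{2x(w) + y(w)}`** (as reals, `a, b > 0`).
[cite: DuminilCopinHammond2013, §2.4] -/
theorem wprod_tilt21_eq {a b : ℕ} (ha : 0 < a) (hb : 0 < b) (w : List Step) :
    (WordAutomaton.wprod (tilt21 a b) w : ℝ) =
      (((a : ℝ) * b) ^ 2) ^ w.length * ((a : ℝ) / b) ^ (2 * wEnd w 0 + wEnd w 1) := by
  have ha' : (a : ℝ) ≠ 0 := by positivity
  have hb' : (b : ℝ) ≠ 0 := by positivity
  have hq : (a : ℝ) / b ≠ 0 := div_ne_zero ha' hb'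
  induction w with
  | nil => simp
  | cons d w ih =>
    have hd : (tilt21 a b d : ℝ) = ((a : ℝ) * b) ^ 2 * ((a : ℝ) / b) ^ (2 * Step.dx d + Step.dy d) := by
      fin_cases d <;> simp [tilt21, wts, Step.dx, Step.dy] <;> field_simp
    rw [WordAutomaton.wprod_cons, Nat.cast_mul, ih, List.length_cons, pow_succ, wEnd_cons]
    simp only [Pi.add_apply, Step.vec_apply_zero, Step.vec_apply_one]
    have hsplit : ((a : ℝ) / b) ^ (2 * (Step.dx d + wEnd w 0) + (Step.dy d + wEnd w 1)) =
        ((a : ℝ) / b) ^ (2 * Step.dx d + Step.dy d) * ((a : ℝ) / b) ^ (2 * wEnd w 0 + wEnd w 1) := by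
      rw [← zpow_add₀ hq]; congr 1; ring
    rw [hsplit, hd]; ring

/-- The `(2,1)` readout of the endpoint: `2x(w) + y(w) = 2(wEnd w)₀ + (wEnd w)₁`. [cite: MadrasSlade1993, §1.1] -/
theorem d21_traj_length (w : List Step) :
    2 * traj w w.length 0 + traj w w.length 1 = 2 * wEnd w 0 + wEnd w 1 := by
  rw [traj_length]

/-- **Exponential tilting bound, `(2,1)` readout**: from `checkT` with the `(2,1)`-tilt weights (`0 < b ≤ a`),
`#{w ∈ sawWords n : 2x(w) + y(w) ≥ m} ≤ 2⁴¹ · (N/(D·a²·b²))ⁿ · (b/a)^m`. [cite: DuminilCopinHammond2013, §2.4] -/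
theorem card_sawWords_d21_ge_le {K a b N D iters : ℕ}
    (h : checkT K (a ^ 4) (a ^ 3 * b) (b ^ 4) (a * b ^ 3) N D iters = true)
    (hb : 0 < b) (hba : b ≤ a) (hD : 0 < D) (n : ℕ) (m : ℤ) :
    (((sawWords n).filter fun w => m ≤ 2 * traj w w.length 0 + traj w w.length 1).card : ℝ) ≤
      2 ^ 41 * ((N : ℝ) / (D * (a * a) * (b * b))) ^ n * ((b : ℝ) / a) ^ m := by
  have ha : 0 < a := lt_of_lt_of_le hb hba
  have hab0 : (0 : ℝ) < ((a : ℝ) * b) ^ 2 := by positivity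
  have hr1 : (1 : ℝ) ≤ (a : ℝ) / b := by
    rw [le_div_iff₀ (by exact_mod_cast hb), one_mul]; exact_mod_cast hba
  have hr0 : (0 : ℝ) < (a : ℝ) / b := by positivity
  set F := (sawWords n).filter fun w => m ≤ 2 * traj w w.length 0 + traj w w.length 1 with hF
  have hlow : (F.card : ℝ) * ((((a : ℝ) * b) ^ 2) ^ n * ((a : ℝ) / b) ^ m) ≤
      ∑ w ∈ sawWords n, (WordAutomaton.wprod (tilt21 a b) w : ℝ) := by
    calc (F.card : ℝ) * ((((a : ℝ) * b) ^ 2) ^ n * ((a : ℝ) / b) ^ m)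
        = ∑ w ∈ F, (((a : ℝ) * b) ^ 2) ^ n * ((a : ℝ) / b) ^ m := by rw [sum_const, nsmul_eq_mul]
      _ ≤ ∑ w ∈ F, (WordAutomaton.wprod (tilt21 a b) w : ℝ) := by
          refine sum_le_sum fun w hw => ?_
          rw [hF, mem_filter, mem_sawWords, d21_traj_length] at hw
          rw [wprod_tilt21_eq ha hb, hw.1.1]
          exact mul_le_mul_of_nonneg_left (zpow_le_zpow_right₀ hr1 hw.2) (pow_nonneg hab0.le _)
      _ ≤ ∑ w ∈ sawWords n, (WordAutomaton.wprod (tilt21 a b) w : ℝ) :=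
          sum_le_sum_of_subset_of_nonneg (filter_subset _ _) fun _ _ _ => Nat.cast_nonneg _
  have hup : (∑ w ∈ sawWords n, (WordAutomaton.wprod (tilt21 a b) w : ℝ)) * (D : ℝ) ^ n ≤
      (N : ℝ) ^ n * 2 ^ 41 := by
    have := sum_sawWords_wts_mul_pow_le_of_checkT (w0 := a ^ 4) (w1 := a ^ 3 * b) (w2 := b ^ 4)
      (w3 := a * b ^ 3) h n
    exact_mod_cast this
  have hDn : (0 : ℝ) < (D : ℝ) ^ n := by positivity
  have hpos : (0 : ℝ) < (((a : ℝ) * b) ^ 2) ^ n * ((a : ℝ) / b) ^ m := mul_pos (pow_pos hab0 _) (zpow_pos hr0 _)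
  have key : (F.card : ℝ) * ((((a : ℝ) * b) ^ 2) ^ n * ((a : ℝ) / b) ^ m) * (D : ℝ) ^ n ≤ (N : ℝ) ^ n * 2 ^ 41 :=
    le_trans (mul_le_mul_of_nonneg_right hlow hDn.le) hup
  have hrew : 2 ^ 41 * ((N : ℝ) / (D * (a * a) * (b * b))) ^ n * ((b : ℝ) / a) ^ m =
      (N : ℝ) ^ n * 2 ^ 41 / (((((a : ℝ) * b) ^ 2) ^ n * ((a : ℝ) / b) ^ m) * (D : ℝ) ^ n) := by
    rw [div_pow, show ((b : ℝ) / a) = ((a : ℝ) / b)⁻¹ by rw [inv_div], inv_zpow]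
    field_simp
    ring
  rw [hrew, le_div_iff₀ (mul_pos hpos hDn), ← mul_assoc]
  exact key

/-- **Max-over-time bound along `2x + y`** from a `(2,1)`-tilted certificate (`0 < b < a`, `N/(Da²b²) ≥ 2.689`):
`#{w ∈ sawWords n : ∃ k ≤ n, 2x(traj w k) + y(traj w k) ≥ m} ≤ (n+1) · 2⁸² · (N/(Da²b²))ⁿ · (b/a)^m`.
[cite: DuminilCopinHammond2013, Thm 1.1] -/
theorem card_maxEvent21_le_of_checkT {K a b N D iters : ℕ}
    (h : checkT K (a ^ 4) (a ^ 3 * b) (b ^ 4) (a * b ^ 3) N D iters = true)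
    (hb : 0 < b) (hba : b < a) (hD : 0 < D) (hbig : (2689 / 1000 : ℝ) ≤ (N : ℝ) / (D * (a * a) * (b * b)))
    (n : ℕ) (m : ℤ) :
    (((sawWords n).filter fun w => ∃ k ≤ n, m ≤ 2 * traj w k 0 + traj w k 1).card : ℝ) ≤
      (n + 1) * 2 ^ 82 * ((N : ℝ) / (D * (a * a) * (b * b))) ^ n * ((b : ℝ) / a) ^ m := by
  have ha : 0 < a := lt_trans hb hba
  have hl0 : (0 : ℝ) ≤ (N : ℝ) / (D * (a * a) * (b * b)) := by positivity
  set lam : ℝ := (N : ℝ) / (D * (a * a) * (b * b)) with hlam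
  have hc : ∀ j : ℕ, ((sawWords j).card : ℝ) ≤ 2 ^ 41 * lam ^ j := by
    intro j
    have h1 := count_mul_pow_le_of_checkC checkC_18 j
    rw [← count_eq_card_sawWords]
    have h2 : (count j : ℝ) * (1000 : ℝ) ^ j ≤ (2689 : ℝ) ^ j * 2 ^ 41 := by exact_mod_cast h1
    have h3 : (count j : ℝ) ≤ 2 ^ 41 * (2689 / 1000 : ℝ) ^ j := by
      rw [div_pow, mul_div_assoc', le_div_iff₀ (by positivity)]; linarith
    exact le_trans h3 (by gcongr)
  have hA : ∀ k : ℕ, ((((sawWords k).filter fun u => m ≤ 2 * traj u u.length 0 + traj u u.length 1).card : ℝ)) ≤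
      2 ^ 41 * lam ^ k * ((b : ℝ) / a) ^ m := fun k => card_sawWords_d21_ge_le h hb hba.le hD k m
  have hfp := card_maxEvent_le_sum (fun z => 2 * z 0 + z 1) n m
  calc (((sawWords n).filter fun w => ∃ k ≤ n, m ≤ 2 * traj w k 0 + traj w k 1).card : ℝ)
      ≤ ∑ k ∈ range (n + 1), ((((sawWords k).filter fun u => m ≤ 2 * traj u u.length 0 + traj u u.length 1).card : ℝ)) *
          ((sawWords (n - k)).card : ℝ) := by exact_mod_cast hfp
    _ ≤ ∑ k ∈ range (n + 1), (2 ^ 41 * lam ^ k * ((b : ℝ) / a) ^ m) * (2 ^ 41 * lam ^ (n - k)) :=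
        sum_le_sum fun k _ => mul_le_mul (hA k) (hc (n - k)) (Nat.cast_nonneg _) (by positivity)
    _ = ∑ k ∈ range (n + 1), 2 ^ 82 * lam ^ n * ((b : ℝ) / a) ^ m := by
        refine sum_congr rfl fun k hk => ?_
        rw [mem_range] at hk
        have : lam ^ k * lam ^ (n - k) = lam ^ n := by rw [← pow_add]; congr 1; omega
        calc 2 ^ 41 * lam ^ k * ((b : ℝ) / a) ^ m * (2 ^ 41 * lam ^ (n - k))
            = 2 ^ 41 * 2 ^ 41 * (lam ^ k * lam ^ (n - k)) * ((b : ℝ) / a) ^ m := by ring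
          _ = _ := by rw [this]; norm_num
    _ = (n + 1) * 2 ^ 82 * lam ^ n * ((b : ℝ) / a) ^ m := by
        rw [sum_const, card_range, nsmul_eq_mul]; push_cast; ring

/-! ### The sixteen-direction covering of the plane -/

/-- Case 1 of the covering polygon: `a ≤ 0.2296 R`, `b < 0.9732 R`. [folklore] -/
private theorem dir16_case1 {R a b : ℝ} (ha : 0 ≤ a) (hb : 0 ≤ b)
    (hA : a ≤ 2296 / 10000 * R) (hbR : b < 9732 / 10000 * R) : a ^ 2 + b ^ 2 < R ^ 2 := by
  have ha2 : a ^ 2 ≤ (2296 / 10000 * R) ^ 2 := pow_le_pow_left₀ ha hA 2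
  have hb2 : b ^ 2 < (9732 / 10000 * R) ^ 2 := pow_lt_pow_left₀ hbR hb (by norm_num)
  nlinarith

/-- Case 2: `0.2296 R ≤ a ≤ 0.6158 R`, `2b < 2.176 R − a`. [folklore] -/
private theorem dir16_case2 {R a b : ℝ} (hb : 0 ≤ b)
    (hA1 : 2296 / 10000 * R ≤ a) (hA2 : a ≤ 6158 / 10000 * R) (hb' : b < (2176 / 1000 * R - a) / 2) :
    a ^ 2 + b ^ 2 < R ^ 2 := by
  have hb2 : b ^ 2 < ((2176 / 1000 * R - a) / 2) ^ 2 := pow_lt_pow_left₀ hb' hb (by norm_num)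
  have hprod : 0 ≤ (a - 2296 / 10000 * R) * (6158 / 10000 * R - a) := mul_nonneg (by linarith) (by linarith)
  nlinarith

/-- Case 3: `0.6158 R ≤ a ≤ 0.7801 R`, `b < 1.3959 R − a`. [folklore] -/
private theorem dir16_case3 {R a b : ℝ} (hb : 0 ≤ b)
    (hA1 : 6158 / 10000 * R ≤ a) (hA2 : a ≤ 7801 / 10000 * R) (hb' : b < 13959 / 10000 * R - a) :
    a ^ 2 + b ^ 2 < R ^ 2 := by
  have hb2 : b ^ 2 < (13959 / 10000 * R - a) ^ 2 := pow_lt_pow_left₀ hb' hb (by norm_num)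
  have hprod : 0 ≤ (a - 6158 / 10000 * R) * (7801 / 10000 * R - a) := mul_nonneg (by linarith) (by linarith)
  nlinarith

/-- Case 4: `0.7801 R ≤ a < 0.9732 R`, `b < 2.176 R − 2a`. [folklore] -/
private theorem dir16_case4 {R a b : ℝ} (hR : 0 < R) (hb : 0 ≤ b)
    (hA1 : 7801 / 10000 * R ≤ a) (hA2 : a < 9732 / 10000 * R) (hb' : b < 2176 / 1000 * R - 2 * a) :
    a ^ 2 + b ^ 2 < R ^ 2 := by
  have hb2 : b ^ 2 < (2176 / 1000 * R - 2 * a) ^ 2 := pow_lt_pow_left₀ hb' hb (by norm_num)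
  have hprod : 0 ≤ (a - 7801 / 10000 * R) * (9732 / 10000 * R - a) := mul_nonneg (by linarith) (by linarith)
  nlinarith

/-- The covering polygon lies inside the disc: `a, b ≥ 0`, `a, b < 0.9732R`, `a + b < 1.3959R`,
`2a + b < 2.176R`, `a + 2b < 2.176R` imply `a² + b² < R²` (`R > 0`). [folklore] -/
private theorem dir16_polygon {R a b : ℝ} (hR : 0 < R) (ha : 0 ≤ a) (hb : 0 ≤ b)
    (haR : a < 9732 / 10000 * R) (hbR : b < 9732 / 10000 * R) (habR : a + b < 13959 / 10000 * R)
    (h2ab : 2 * a + b < 2176 / 1000 * R) (ha2b : a + 2 * b < 2176 / 1000 * R) : a ^ 2 + b ^ 2 < R ^ 2 := by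
  rcases le_or_gt a (2296 / 10000 * R) with hA1 | hA1
  · exact dir16_case1 ha hb hA1 hbR
  rcases le_or_gt a (6158 / 10000 * R) with hA2 | hA2
  · exact dir16_case2 hb hA1.le hA2 (by linarith)
  rcases le_or_gt a (7801 / 10000 * R) with hA3 | hA3
  · exact dir16_case3 hb hA2.le hA3 (by linarith)
  · exact dir16_case4 hR hb hA3.le haR (by linarith)

/-- Planar geometry: if `x² + y² ≥ R²` (`R ≥ 0`) then one of the sixteen lattice directions `(±1,0), (0,±1),
(±1,±1), (±2,±1), (±1,±2)` sees the point at projection level `0.9732 R` (axes), `1.3959 R` (diagonals, readout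
`x ± y`) or `2.176 R` (readout `2x ± y`, `x ± 2y`): the half-gaps of the sixteen directions are `13.28°` and `9.22°`.
[cite: DuminilCopinHammond2013, Thm 1.1] -/
theorem exists_dir16_ge_of_euclidNorm_ge {R : ℝ} (hR : 0 ≤ R) {z : Site 2} (h : R ≤ Zd.euclidNorm z) :
    ((9732 / 10000 * R ≤ (z 0 : ℝ) ∨ 9732 / 10000 * R ≤ -(z 0 : ℝ) ∨
      9732 / 10000 * R ≤ (z 1 : ℝ) ∨ 9732 / 10000 * R ≤ -(z 1 : ℝ)) ∨
    (13959 / 10000 * R ≤ (z 0 : ℝ) + z 1 ∨ 13959 / 10000 * R ≤ -((z 0 : ℝ) + z 1) ∨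
      13959 / 10000 * R ≤ (z 0 : ℝ) - z 1 ∨ 13959 / 10000 * R ≤ -((z 0 : ℝ) - z 1))) ∨
    ((2176 / 1000 * R ≤ 2 * (z 0 : ℝ) + z 1 ∨ 2176 / 1000 * R ≤ -(2 * (z 0 : ℝ) + z 1) ∨
      2176 / 1000 * R ≤ 2 * (z 0 : ℝ) - z 1 ∨ 2176 / 1000 * R ≤ -(2 * (z 0 : ℝ) - z 1)) ∨
    (2176 / 1000 * R ≤ (z 0 : ℝ) + 2 * z 1 ∨ 2176 / 1000 * R ≤ -((z 0 : ℝ) + 2 * z 1) ∨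
      2176 / 1000 * R ≤ (z 0 : ℝ) - 2 * z 1 ∨ 2176 / 1000 * R ≤ -((z 0 : ℝ) - 2 * z 1))) := by
  have hsq : R ^ 2 ≤ ((z 0 : ℝ)) ^ 2 + ((z 1 : ℝ)) ^ 2 := by
    have := pow_le_pow_left₀ hR h 2
    rw [Zd.sq_euclidNorm, Fin.sum_univ_two] at this
    exact this
  set x : ℝ := (z 0 : ℝ) with hx
  set y : ℝ := (z 1 : ℝ) with hy
  by_contra hcon
  simp only [not_or, not_le] at hcon
  obtain ⟨⟨⟨h1, h2, h3, h4⟩, h5, h6, h7, h8⟩, ⟨h9, h10, h11, h12⟩, h13, h14, h15, h16⟩ := hcon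
  rcases eq_or_lt_of_le hR with hR0 | hRpos
  · -- `R = 0`: `0 ≤ x` or `0 ≤ -x`
    rw [← hR0] at h1 h2
    linarith
  -- absolute values: `a = |x|`, `b = |y|` satisfy the five polygon constraints
  have hbounds : |x| < 9732 / 10000 * R ∧ |y| < 9732 / 10000 * R ∧ |x| + |y| < 13959 / 10000 * R ∧
      2 * |x| + |y| < 2176 / 1000 * R ∧ |x| + 2 * |y| < 2176 / 1000 * R := by
    rcases le_or_gt 0 x with hx0 | hx0 <;> rcases le_or_gt 0 y with hy0 | hy0
    · rw [abs_of_nonneg hx0, abs_of_nonneg hy0]; exact ⟨h1, h3, by linarith, by linarith, by linarith⟩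
    · rw [abs_of_nonneg hx0, abs_of_neg hy0]; exact ⟨h1, by linarith, by linarith, by linarith, by linarith⟩
    · rw [abs_of_neg hx0, abs_of_nonneg hy0]; exact ⟨by linarith, h3, by linarith, by linarith, by linarith⟩
    · rw [abs_of_neg hx0, abs_of_neg hy0]
      exact ⟨by linarith, by linarith, by linarith, by linarith, by linarith⟩
  obtain ⟨hax, hay, hsum, hs21, hs12⟩ := hbounds
  have hlt := dir16_polygon hRpos (abs_nonneg x) (abs_nonneg y) hax hay hsum hs21 hs12
  rw [sq_abs, sq_abs] at hlt
  linarith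

end Literature.Probability.RandomPlanarGeometry.SAW
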